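/-
Copyright: statement-level skeleton of a published paper (lit-balaban cell, Phase-2 proof seat p39 gen 10). No proof claims
beyond what the kernel checks below.
-/
import Literature.MathematicalPhysics.QuantumFieldTheory.Balaban1983to89.B3Eq316DifferenceKernelBounds
import Literature.MathematicalPhysics.QuantumFieldTheory.Balaban1983to89.B3Eq338Middle

/-!
# B3 — T. Bałaban, *(Higgs)₂,₃ quantum fields in a finite volume. III. Renormalization*, CMP **88** (1983) 411–445
[Balaban1983Higgs3], p. 444 [PDF 34], the triangle factor of the graphs **(2.20)** — the first member of **(3.38)** with its
three propagator slots as two-variable kernels on ξℤ³ — and its SUMMATION-BY-PARTS FORM (model-free kernel calculus; the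
estimates at the zero-field instance are in `B3Eq338ZeroLattice`)

statement-level skeleton of published theorems with citation tags; proofs where landed; nothing here is a claim about
the Yang–Mills mass gap

PDF held: `paper:balaban1983-higgs-2-3-quantum-fields-finite-volume` (journal page = PDF page + 410); p. 444 [PDF 34] read on the
×2 render `run/shared/lean/pub/pub-balaban/b2b-balaban-ref1/pages/1983-cmp88-higgs23-III/1983-cmp88-higgs23-III-p034-x2.png`,
verbatim: *"Now we replace the propagators G^η_{j₀}(0), G^η_{j₀} by C^ξ in the way described several times. We get a convergent
expression plus Σ_{y,y″}ξ^{2d}Γ″_μ(y,y′,y″) defined with the help of the propagator C^ξ. … Finally for the graphs (2.20) it equals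
−q³ Σ_{y,y″} ξ^{2d} Σ_{ν=1}^d [(∂^ξ_νC^ξ)(y′−y)(∂^ξ_μC^ξ∂^{ξ*}_ν)(y−y″)C^ξ(y′−y″) − (∂^ξ_νC^ξ∂^{ξ*}_μ)(y′−y)(C^ξ∂^{ξ*}_ν)(y−y″)C^ξ(y′−y″)]
= −q³ Σ_{y,y″} ξ^{2d}(−Δ^ξC^ξ)(y″)C^ξ(y″−y)((∂^ξ_μC^ξ)(y) − (∂^{ξ*}_μC^ξ)(y)) = … = 0, (3.38) because the functions which we are
summing are odd."*  Row **B3.Eq3.33-3.38** of `HOME/lit-balaban-r15/ROWS-B3.md` (fold owner r15).  CONTEXT.  The printed first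
member of (3.38) is r15's `B3Sect3TriangleGraphs.lhs338` (convolution kernels `C(y′−y)` etc.); its vanishing for `C^ξ` is r15's
`B3Eq338Middle.eq338_direct` / p03's `B3Eq324Parseval.eq338_holds` with `lhs338_eq_zero_of_eq338`.  For the REPLACEMENT sentence
(`G_{j₀}(0)`, `G_{j₀}` in the slots; *"a convergent expression plus"* the pure-`C^ξ` term) the three lines of the triangle (2.20) —
`y′–y` (scalar, `∂^ξ_ν` at `y′`), `y–y″` (scalar, `∂^ξ_μ…∂^{ξ*}_ν`), `y′–y″` (the vector line) — must carry arbitrary two-variable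
kernels `K₁(y′,y)`, `K₂(y,y″)`, `K₃(y′,y″)`, since the lattice propagator `G^ξ_k(0)` is not translation invariant.  THIS FILE
(model-free) types that three-slot factor and proves the algebraic identity behind the estimates: the factor is of DEGREE 0
(p. 444 *"The expression Σ_{x,x″}η^{2d}Γ′_μ(x,x′,x″) is of degree 0"*), each printed product alone is only logarithmically
bounded, and the uniform bounds of `B3Eq338ZeroLattice` are obtained after moving one lattice difference off the doubly
differentiated line by summation by parts — twice: in `y″` for the first product, in `y` for the second.
WHAT IS PROVED (`ξ` = spacing, volume element `Σ ξ³`; `dK1`/`dK2`/`d2K` = `∂^ξ(first variable)`, `∂^{ξ*}`-type forward difference in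
the second variable, mixed second difference, of `B3Eq316DifferenceKernelBounds`; `unitVec`, `pdiffZ`, `pdiffAdjZ` of r15):
* §1 `tsum_fwdDiff_mul` — summation by parts on ℤ³: `Σ'_w (g(w+e) − g(w))f(w) = Σ'_w g(w)(f(w−e) − f(w))`; `d2K_eq_dK2_dK1`.
* §2 DEFINITIONS: **`tri20`** — the first member of (3.38) with kernel slots,
  `T[K₁,K₂,K₃](y′) = −q³Σ'_yΣ'_{y″}ξ⁶Σ_ν[(∂_νK₁)(y′,y)(∂_μK₂∂^*_ν)(y,y″)K₃(y′,y″) − (∂_νK₁∂^*_μ)(y′,y)(K₂∂^*_ν)(y,y″)K₃(y′,y″)]`;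
  **`Lker`** — `L(x) = Σ'_{y″}ξ³(∂_μK₂∂^*_ν)(x,y″)K₃(y′,y″)`; **`Nker`** — `N(x) = Σ'_{y″}ξ³(K₂∂^*_ν)(x,y″)K₃(y′,y″)`; **`sbpForm`** —
  `−q³Σ_νΣ'_yξ³(∂_νK₁)(y′,y)[L(y) + L(y − e_μ)]`.
* §3 THE IDENTITIES (under the stated summability hypotheses, all satisfied by exponentially decaying kernels):
  `Lker_eq_sbp` (`L(x) = Σ'_{w}ξ³(∂_μK₂)(x,w)·ξ^{−1}(K₃(y′,w−e_ν) − K₃(y′,w))` — the `y″`-summation by parts), `Nker_sub`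
  (`N(y) − N(y−e_μ) = ξ·L(y−e_μ)`), `tsum_d2K_mul_Nker` (`Σ'_yξ³(∂_νK₁∂^*_μ)(y′,y)N(y) = −Σ'_yξ³(∂_νK₁)(y′,y)L(y−e_μ)` — the
  `y`-summation by parts), `Lker_add_mid`/`Lker_add_right`/`dK1_add` (additivity in the slots), **`tri20_eq_sbpForm`** — `T[K₁,K₂,K₃] = −q³Σ_νΣ'_yξ³(∂_νK₁)(y′,y)[L(y) + L(y−e_μ)]`.
* §4 ON CONVOLUTION KERNELS `(a,b) ↦ C(a−b)`: `dK1_conv`; `tri20_conv` — `T[C,C,C]` IS r15's printed `lhs338` (`d = 3`);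
  **`tri20_conv_Cxi`** — hence
  `T[C^ξ,C^ξ,C^ξ](y′) = 0` for `ξ > 0` ((3.38), `B3Eq338Middle.eq338_direct`).
HONEST SCOPE: pure lattice calculus, no estimates; `d = 3` is fixed only because the kernel differences of
`B3Eq316DifferenceKernelBounds` are typed on `ℤ³`.  Mathlib + the cited tree files only; four model-free `def`s with bodies
(`tri20`, `Lker`, `Nker`, `sbpForm`) and theorems; no named facts; standard axioms.  Unit `lit-balaban-p39-g10` (Phase-2 proof
seat p39, gen 10), HOME `run/shared/lean/pub/lit-balaban/`, 2026-08-22.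
-/

open scoped BigOperators
open Finset Filter Topology

namespace Literature.MathematicalPhysics.QuantumFieldTheory.Balaban1983to89.B3Eq338KernelForm

open B3Sect3VectorSelfEnergy B3CxiUniformBound B3Eq316DifferenceKernelBounds
open B3Sect3TriangleGraphs (lhs338 lhs338_eq_zero_of_eq338)

noncomputable section

/-! ## §1 Summation by parts on ℤ³ and the order of the two differences -/

section SBP

/-- **Summation by parts on ℤ³**: `Σ'_w (g(w+e) − g(w))·f(w) = Σ'_w g(w)·(f(w−e) − f(w))`, for any lattice vector `e`, when
`w ↦ g(w+e)f(w)` and `w ↦ g(w)f(w)` are summable (the shifted series is re-indexed by `w ↦ w − e`). [cite: Balaban1983Higgs3, (3.38) p.444] -/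
theorem tsum_fwdDiff_mul (e : ZSite 3) {g f : ZSite 3 → ℝ} (h1 : Summable fun w => g (w + e) * f w)
    (h2 : Summable fun w => g w * f w) :
    ∑' w, (g (w + e) - g w) * f w = ∑' w, g w * (f (w - e) - f w) := by
  have h3 : Summable fun w => g w * f (w - e) := by
    refine ((Equiv.subRight e).summable_iff.mpr h1).congr fun w => ?_
    simp only [Function.comp_apply, Equiv.subRight_apply, sub_add_cancel]
  have key : ∑' w, g (w + e) * f w = ∑' w, g w * f (w - e) := by
    have h := (Equiv.subRight e).tsum_eq (fun w => g (w + e) * f w)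
    simp only [Equiv.subRight_apply, sub_add_cancel] at h
    exact h.symm
  simp only [sub_mul, mul_sub]
  rw [h1.tsum_sub h2, h3.tsum_sub h2, key]

/-- kernel: summability of a shifted product from the unshifted one, re-indexed (`w ↦ g(w)f(w−e)` from `w ↦ g(w+e)f(w)`).
[cite: Balaban1983Higgs3, (3.38) p.444] -/
theorem summable_shift_mul (e : ZSite 3) {g f : ZSite 3 → ℝ} (h1 : Summable fun w => g (w + e) * f w) :
    Summable fun w => g w * f (w - e) := by
  refine ((Equiv.subRight e).summable_iff.mpr h1).congr fun w => ?_
  simp only [Function.comp_apply, Equiv.subRight_apply, sub_add_cancel]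

/-- kernel: the mixed second difference is the second-variable difference of the first-variable difference (the two lattice
differences commute). [cite: Balaban1983Higgs3, (3.38) p.444] -/
theorem d2K_eq_dK2_dK1 (ξ : ℝ) (μ' μ : Fin 3) (K : ZSite 3 → ZSite 3 → ℝ) (x y : ZSite 3) :
    d2K ξ μ' μ K x y = dK2 ξ μ (dK1 ξ μ' K) x y := by
  unfold d2K dK1 dK2; ring

end SBP

/-! ## §2 The triangle factor of (2.20) with kernel slots, and its summation-by-parts form -/

section Defs

/-- **the triangle factor of the graphs (2.20)** — the first member of (3.38) with its three propagator slots as two-variable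
kernels on ξℤ³ (`K₁` on the line `y′–y`, differentiated at `y′`; `K₂` on the line `y–y″`; `K₃` on the line `y′–y″`):
`T[K₁,K₂,K₃](y′) = −q³Σ'_yΣ'_{y″}ξ⁶Σ_ν[(∂^ξ_νK₁)(y′,y)(∂^ξ_μK₂∂^{ξ*}_ν)(y,y″)K₃(y′,y″) − (∂^ξ_νK₁∂^{ξ*}_μ)(y′,y)(K₂∂^{ξ*}_ν)(y,y″)K₃(y′,y″)]`
(iterated lattice sums as in r15's `lhs338`; `q3` = q³ as a real scalar). [cite: Balaban1983Higgs3, (3.38) p.444] -/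
def tri20 (ξ q3 : ℝ) (μ : Fin 3) (K₁ K₂ K₃ : ZSite 3 → ZSite 3 → ℝ) (y' : ZSite 3) : ℝ :=
  -q3 * ∑' y : ZSite 3, ∑' w : ZSite 3, ξ ^ 6 * ∑ ν : Fin 3,
    (dK1 ξ ν K₁ y' y * d2K ξ μ ν K₂ y w * K₃ y' w - d2K ξ ν μ K₁ y' y * dK2 ξ ν K₂ y w * K₃ y' w)

/-- **`L(x)`** — the `y″`-sum of the first product without its first line: `L(x) = Σ'_{y″}ξ³(∂^ξ_μK₂∂^{ξ*}_ν)(x,y″)K₃(y′,y″)`.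
[cite: Balaban1983Higgs3, (3.38) p.444] -/
def Lker (ξ : ℝ) (μ ν : Fin 3) (K₂ K₃ : ZSite 3 → ZSite 3 → ℝ) (y' x : ZSite 3) : ℝ :=
  ∑' w : ZSite 3, ξ ^ 3 * (d2K ξ μ ν K₂ x w * K₃ y' w)

/-- **`N(x)`** — the `y″`-sum of the second product without its first line: `N(x) = Σ'_{y″}ξ³(K₂∂^{ξ*}_ν)(x,y″)K₃(y′,y″)`.
[cite: Balaban1983Higgs3, (3.38) p.444] -/
def Nker (ξ : ℝ) (ν : Fin 3) (K₂ K₃ : ZSite 3 → ZSite 3 → ℝ) (y' x : ZSite 3) : ℝ :=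
  ∑' w : ZSite 3, ξ ^ 3 * (dK2 ξ ν K₂ x w * K₃ y' w)

/-- **the summation-by-parts form of the triangle factor**: `−q³Σ_νΣ'_yξ³(∂^ξ_νK₁)(y′,y)·[L(y) + L(y − e_μ)]` — one lattice difference
on each of the three lines of the first product (the form in which the factor is estimated). [cite: Balaban1983Higgs3, (3.38) p.444] -/
def sbpForm (ξ q3 : ℝ) (μ : Fin 3) (K₁ K₂ K₃ : ZSite 3 → ZSite 3 → ℝ) (y' : ZSite 3) : ℝ :=
  -q3 * ∑ ν : Fin 3, ∑' y : ZSite 3, ξ ^ 3 *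
    (dK1 ξ ν K₁ y' y * (Lker ξ μ ν K₂ K₃ y' y + Lker ξ μ ν K₂ K₃ y' (y - unitVec μ)))

end Defs

/-! ## §3 The identities -/

section Identities

variable {ξ : ℝ} {μ ν : Fin 3} {K₁ K₂ K₃ : ZSite 3 → ZSite 3 → ℝ} {y' : ZSite 3}

/-- **THE `y″`-SUMMATION BY PARTS** (first product): `L(x) = Σ'_wξ³(∂^ξ_μK₂)(x,w)·ξ^{−1}(K₃(y′,w−e_ν) − K₃(y′,w))` — the
`∂^{ξ*}_ν` of the doubly differentiated line `y–y″` moved onto the line `y′–y″` (r15's `pdiffAdjZ` of `K₃(y′,·)`), valid when the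
two products `(∂_μK₂)(x,w+e_ν)K₃(y′,w)`, `(∂_μK₂)(x,w)K₃(y′,w)` are summable in `w`. [cite: Balaban1983Higgs3, (3.38) p.444] -/
theorem Lker_eq_sbp (x : ZSite 3) (h1 : Summable fun w => dK1 ξ μ K₂ x (w + unitVec ν) * K₃ y' w)
    (h2 : Summable fun w => dK1 ξ μ K₂ x w * K₃ y' w) :
    Lker ξ μ ν K₂ K₃ y' x = ∑' w : ZSite 3, ξ ^ 3 * (dK1 ξ μ K₂ x w * pdiffAdjZ ξ⁻¹ ν (K₃ y') w) := by
  unfold Lker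
  have e1 : ∀ w, ξ ^ 3 * (d2K ξ μ ν K₂ x w * K₃ y' w) =
      ξ ^ 3 * ξ⁻¹ * ((dK1 ξ μ K₂ x (w + unitVec ν) - dK1 ξ μ K₂ x w) * K₃ y' w) := by
    intro w; rw [d2K_eq_dK2_dK1]; unfold dK2; ring
  have e2 : ∀ w, ξ ^ 3 * (dK1 ξ μ K₂ x w * pdiffAdjZ ξ⁻¹ ν (K₃ y') w) =
      ξ ^ 3 * ξ⁻¹ * (dK1 ξ μ K₂ x w * (K₃ y' (w - unitVec ν) - K₃ y' w)) := by
    intro w; unfold pdiffAdjZ; ring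
  rw [tsum_congr e1, tsum_congr e2, tsum_mul_left, tsum_mul_left, tsum_fwdDiff_mul (unitVec ν) h1 h2]

/-- **`N(y) − N(y − e_μ) = ξ·L(y − e_μ)`** — the `∂^ξ_μ` of the second product's middle line, read as a difference of the
`y″`-sums (`ξ ≠ 0`; the two `N`-series summable). [cite: Balaban1983Higgs3, (3.38) p.444] -/
theorem Nker_sub (hξ : ξ ≠ 0) (hN : ∀ x, Summable fun w => ξ ^ 3 * (dK2 ξ ν K₂ x w * K₃ y' w)) (y : ZSite 3) :
    Nker ξ ν K₂ K₃ y' y - Nker ξ ν K₂ K₃ y' (y - unitVec μ) = ξ * Lker ξ μ ν K₂ K₃ y' (y - unitVec μ) := by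
  unfold Nker Lker
  rw [← (hN y).tsum_sub (hN (y - unitVec μ)), ← tsum_mul_left]
  refine tsum_congr fun w => ?_
  rw [d2K_eq_dK1_dK2]
  unfold dK1
  rw [sub_add_cancel]
  have hc : ξ * ξ⁻¹ = 1 := mul_inv_cancel₀ hξ
  linear_combination (-(ξ ^ 3 * ((dK2 ξ ν K₂ y w - dK2 ξ ν K₂ (y - unitVec μ) w) * K₃ y' w))) * hc

/-- **THE `y`-SUMMATION BY PARTS** (second product): `Σ'_yξ³(∂^ξ_νK₁∂^{ξ*}_μ)(y′,y)N(y) = −Σ'_yξ³(∂^ξ_νK₁)(y′,y)L(y − e_μ)` — the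
`∂^{ξ*}_μ` of the doubly differentiated line `y′–y` moved onto the middle line, where it turns `N` into `L` (`Nker_sub`); valid
when `(∂_νK₁)(y′,y+e_μ)N(y)`, `(∂_νK₁)(y′,y)N(y)` are summable in `y` and the `N`-series converge. [cite: Balaban1983Higgs3, (3.38) p.444] -/
theorem tsum_d2K_mul_Nker (hξ : ξ ≠ 0) (hN : ∀ x, Summable fun w => ξ ^ 3 * (dK2 ξ ν K₂ x w * K₃ y' w))
    (hB1 : Summable fun y => dK1 ξ ν K₁ y' (y + unitVec μ) * Nker ξ ν K₂ K₃ y' y)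
    (hB2 : Summable fun y => dK1 ξ ν K₁ y' y * Nker ξ ν K₂ K₃ y' y) :
    ∑' y : ZSite 3, ξ ^ 3 * (d2K ξ ν μ K₁ y' y * Nker ξ ν K₂ K₃ y' y) =
      -∑' y : ZSite 3, ξ ^ 3 * (dK1 ξ ν K₁ y' y * Lker ξ μ ν K₂ K₃ y' (y - unitVec μ)) := by
  have e1 : ∀ y, ξ ^ 3 * (d2K ξ ν μ K₁ y' y * Nker ξ ν K₂ K₃ y' y) =
      ξ ^ 3 * ξ⁻¹ * ((dK1 ξ ν K₁ y' (y + unitVec μ) - dK1 ξ ν K₁ y' y) * Nker ξ ν K₂ K₃ y' y) := by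
    intro y; rw [d2K_eq_dK2_dK1]; unfold dK2; ring
  have e2 : ∀ y, dK1 ξ ν K₁ y' y * (Nker ξ ν K₂ K₃ y' (y - unitVec μ) - Nker ξ ν K₂ K₃ y' y) =
      -ξ * (dK1 ξ ν K₁ y' y * Lker ξ μ ν K₂ K₃ y' (y - unitVec μ)) := by
    intro y; rw [← neg_sub, Nker_sub hξ hN y]; ring
  rw [tsum_congr e1, tsum_mul_left, tsum_fwdDiff_mul (unitVec μ) hB1 hB2, tsum_congr e2, tsum_mul_left, tsum_mul_left]
  have hc : ξ⁻¹ * ξ = 1 := inv_mul_cancel₀ hξ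
  linear_combination (-(ξ ^ 3 * ∑' y : ZSite 3, dK1 ξ ν K₁ y' y * Lker ξ μ ν K₂ K₃ y' (y - unitVec μ))) * hc

/-- kernel: under the hypotheses of `tsum_d2K_mul_Nker` the shifted product `(∂_νK₁)(y′,y)L(y − e_μ)` is summable in `y`.
[cite: Balaban1983Higgs3, (3.38) p.444] -/
theorem summable_dK1_mul_Lker_shift (hξ : ξ ≠ 0) (hN : ∀ x, Summable fun w => ξ ^ 3 * (dK2 ξ ν K₂ x w * K₃ y' w))
    (hB1 : Summable fun y => dK1 ξ ν K₁ y' (y + unitVec μ) * Nker ξ ν K₂ K₃ y' y)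
    (hB2 : Summable fun y => dK1 ξ ν K₁ y' y * Nker ξ ν K₂ K₃ y' y) :
    Summable fun y => ξ ^ 3 * (dK1 ξ ν K₁ y' y * Lker ξ μ ν K₂ K₃ y' (y - unitVec μ)) := by
  have h3 := summable_shift_mul (unitVec μ) hB1
  have h := ((hB2.sub h3).mul_left (ξ ^ 3 * ξ⁻¹))
  refine h.congr fun y => ?_
  rw [← mul_sub, Nker_sub hξ hN y]
  have hc : ξ⁻¹ * ξ = 1 := inv_mul_cancel₀ hξ
  linear_combination (ξ ^ 3 * (dK1 ξ ν K₁ y' y * Lker ξ μ ν K₂ K₃ y' (y - unitVec μ))) * hc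

/-- kernel: `L` is additive in the middle slot (the `∂_μ…∂^*_ν` line), when both series converge. [cite: Balaban1983Higgs3, (3.38) p.444] -/
theorem Lker_add_mid {K₂' : ZSite 3 → ZSite 3 → ℝ} (x : ZSite 3)
    (h : Summable fun w => ξ ^ 3 * (d2K ξ μ ν K₂ x w * K₃ y' w))
    (h' : Summable fun w => ξ ^ 3 * (d2K ξ μ ν K₂' x w * K₃ y' w)) :
    Lker ξ μ ν (fun a b => K₂ a b + K₂' a b) K₃ y' x = Lker ξ μ ν K₂ K₃ y' x + Lker ξ μ ν K₂' K₃ y' x := by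
  unfold Lker
  rw [← h.tsum_add h']
  refine tsum_congr fun w => ?_
  unfold d2K; ring

/-- kernel: `L` is additive in the last slot (the line `y′–y″`), when both series converge. [cite: Balaban1983Higgs3, (3.38) p.444] -/
theorem Lker_add_right {K₃' : ZSite 3 → ZSite 3 → ℝ} (x : ZSite 3)
    (h : Summable fun w => ξ ^ 3 * (d2K ξ μ ν K₂ x w * K₃ y' w))
    (h' : Summable fun w => ξ ^ 3 * (d2K ξ μ ν K₂ x w * K₃' y' w)) :
    Lker ξ μ ν K₂ (fun a b => K₃ a b + K₃' a b) y' x = Lker ξ μ ν K₂ K₃ y' x + Lker ξ μ ν K₂ K₃' y' x := by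
  unfold Lker
  rw [← h.tsum_add h']
  refine tsum_congr fun w => ?_
  ring

/-- kernel: the first-variable difference is additive in the kernel. [cite: Balaban1983Higgs3, (3.38) p.444] -/
theorem dK1_add (ξ : ℝ) (μ : Fin 3) (K K' : ZSite 3 → ZSite 3 → ℝ) (x y : ZSite 3) :
    dK1 ξ μ (fun a b => K a b + K' a b) x y = dK1 ξ μ K x y + dK1 ξ μ K' x y := by
  unfold dK1; ring

/-- **THE SUMMATION-BY-PARTS FORM OF THE TRIANGLE FACTOR OF (2.20)**:
`T[K₁,K₂,K₃](y′) = −q³Σ_νΣ'_yξ³(∂^ξ_νK₁)(y′,y)[L(y) + L(y − e_μ)]`, `L(x) = Σ'_{y″}ξ³(∂^ξ_μK₂∂^{ξ*}_ν)(x,y″)K₃(y′,y″)`, for kernels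
whose `L`- and `N`-series converge and whose first-line products are summable (hypotheses `hL`, `hN`, `hA`, `hB1`, `hB2`; `ξ ≠ 0`)
— the second printed product, summed by parts in `y`, is minus the first with its middle line shifted by `−e_μ`.
[cite: Balaban1983Higgs3, (3.38) p.444] -/
theorem tri20_eq_sbpForm (hξ : ξ ≠ 0) (q3 : ℝ)
    (hL : ∀ (ν : Fin 3) (x : ZSite 3), Summable fun w => ξ ^ 3 * (d2K ξ μ ν K₂ x w * K₃ y' w))
    (hN : ∀ (ν : Fin 3) (x : ZSite 3), Summable fun w => ξ ^ 3 * (dK2 ξ ν K₂ x w * K₃ y' w))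
    (hA : ∀ ν : Fin 3, Summable fun y => ξ ^ 3 * (dK1 ξ ν K₁ y' y * Lker ξ μ ν K₂ K₃ y' y))
    (hB1 : ∀ ν : Fin 3, Summable fun y => dK1 ξ ν K₁ y' (y + unitVec μ) * Nker ξ ν K₂ K₃ y' y)
    (hB2 : ∀ ν : Fin 3, Summable fun y => dK1 ξ ν K₁ y' y * Nker ξ ν K₂ K₃ y' y) :
    tri20 ξ q3 μ K₁ K₂ K₃ y' = sbpForm ξ q3 μ K₁ K₂ K₃ y' := by
  unfold tri20 sbpForm
  congr 1
  -- the summable pieces of the outer sum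
  have hBsum : ∀ ν : Fin 3, Summable fun y => ξ ^ 3 * (d2K ξ ν μ K₁ y' y * Nker ξ ν K₂ K₃ y' y) := by
    intro ν
    have h := ((hB1 ν).sub (hB2 ν)).mul_left (ξ ^ 3 * ξ⁻¹)
    refine h.congr fun y => ?_
    rw [d2K_eq_dK2_dK1]; unfold dK2; ring
  -- step 1: the inner `y″`-sum, for each `y`
  have inner : ∀ y : ZSite 3, ∑' w : ZSite 3, ξ ^ 6 * ∑ ν : Fin 3,
      (dK1 ξ ν K₁ y' y * d2K ξ μ ν K₂ y w * K₃ y' w - d2K ξ ν μ K₁ y' y * dK2 ξ ν K₂ y w * K₃ y' w) =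
      ∑ ν : Fin 3, (ξ ^ 3 * (dK1 ξ ν K₁ y' y * Lker ξ μ ν K₂ K₃ y' y) -
        ξ ^ 3 * (d2K ξ ν μ K₁ y' y * Nker ξ ν K₂ K₃ y' y)) := by
    intro y
    have e : ∀ w : ZSite 3, ξ ^ 6 * ∑ ν : Fin 3,
        (dK1 ξ ν K₁ y' y * d2K ξ μ ν K₂ y w * K₃ y' w - d2K ξ ν μ K₁ y' y * dK2 ξ ν K₂ y w * K₃ y' w) =
        ∑ ν : Fin 3, (ξ ^ 3 * dK1 ξ ν K₁ y' y * (ξ ^ 3 * (d2K ξ μ ν K₂ y w * K₃ y' w)) -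
          ξ ^ 3 * d2K ξ ν μ K₁ y' y * (ξ ^ 3 * (dK2 ξ ν K₂ y w * K₃ y' w))) := by
      intro w
      rw [Finset.mul_sum]
      exact Finset.sum_congr rfl fun ν _ => by ring
    have hs : ∀ ν : Fin 3, Summable fun w : ZSite 3 =>
        ξ ^ 3 * dK1 ξ ν K₁ y' y * (ξ ^ 3 * (d2K ξ μ ν K₂ y w * K₃ y' w)) -
          ξ ^ 3 * d2K ξ ν μ K₁ y' y * (ξ ^ 3 * (dK2 ξ ν K₂ y w * K₃ y' w)) := fun ν =>
      ((hL ν y).mul_left (ξ ^ 3 * dK1 ξ ν K₁ y' y)).sub ((hN ν y).mul_left (ξ ^ 3 * d2K ξ ν μ K₁ y' y))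
    have hν : ∀ ν : Fin 3, ∑' w : ZSite 3,
        (ξ ^ 3 * dK1 ξ ν K₁ y' y * (ξ ^ 3 * (d2K ξ μ ν K₂ y w * K₃ y' w)) -
          ξ ^ 3 * d2K ξ ν μ K₁ y' y * (ξ ^ 3 * (dK2 ξ ν K₂ y w * K₃ y' w))) =
        ξ ^ 3 * (dK1 ξ ν K₁ y' y * Lker ξ μ ν K₂ K₃ y' y) - ξ ^ 3 * (d2K ξ ν μ K₁ y' y * Nker ξ ν K₂ K₃ y' y) := by
      intro ν
      have h1 : ∑' w : ZSite 3, ξ ^ 3 * dK1 ξ ν K₁ y' y * (ξ ^ 3 * (d2K ξ μ ν K₂ y w * K₃ y' w)) =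
          ξ ^ 3 * dK1 ξ ν K₁ y' y * ∑' w : ZSite 3, ξ ^ 3 * (d2K ξ μ ν K₂ y w * K₃ y' w) := tsum_mul_left
      have h2 : ∑' w : ZSite 3, ξ ^ 3 * d2K ξ ν μ K₁ y' y * (ξ ^ 3 * (dK2 ξ ν K₂ y w * K₃ y' w)) =
          ξ ^ 3 * d2K ξ ν μ K₁ y' y * ∑' w : ZSite 3, ξ ^ 3 * (dK2 ξ ν K₂ y w * K₃ y' w) := tsum_mul_left
      rw [((hL ν y).mul_left (ξ ^ 3 * dK1 ξ ν K₁ y' y)).tsum_sub ((hN ν y).mul_left (ξ ^ 3 * d2K ξ ν μ K₁ y' y)),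
        h1, h2]
      unfold Lker Nker
      ring
    rw [tsum_congr e, Summable.tsum_finsetSum (fun ν _ => hs ν)]
    exact Finset.sum_congr rfl fun ν _ => hν ν
  rw [tsum_congr inner, Summable.tsum_finsetSum (fun ν _ => (hA ν).sub (hBsum ν))]
  refine Finset.sum_congr rfl fun ν _ => ?_
  -- step 2: the outer `y`-sum of one `ν`-term, second product summed by parts
  rw [(hA ν).tsum_sub (hBsum ν), tsum_d2K_mul_Nker hξ (hN ν) (hB1 ν) (hB2 ν), sub_neg_eq_add,
    ← (hA ν).tsum_add (summable_dK1_mul_Lker_shift hξ (hN ν) (hB1 ν) (hB2 ν))]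
  exact tsum_congr fun y => by ring

end Identities

/-! ## §4 On convolution kernels: the printed (3.38) and its vanishing -/

section Conv

/-- kernel: `∂^ξ_μ` of a convolution kernel `(a,b) ↦ C(a − b)` is the convolution kernel of `∂^ξ_μC` (companion of
`B3Eq316DifferenceKernelBounds.dK2_conv`, `d2K_conv`). [cite: Balaban1983Higgs3, (3.38) p.444] -/
theorem dK1_conv (ξ : ℝ) (μ : Fin 3) (C : ZSite 3 → ℝ) (x y : ZSite 3) :
    dK1 ξ μ (fun a b => C (a - b)) x y = pdiffZ ξ⁻¹ μ C (x - y) := by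
  unfold dK1 pdiffZ
  simp only [show x + unitVec μ - y = x - y + unitVec μ by abel]

/-- **On convolution kernels the three-slot factor IS the printed first member of (3.38)** (r15's `B3Sect3TriangleGraphs.lhs338`,
`d = 3`): `T[C,C,C](y′) = −q³Σ_{y,y″}ξ⁶Σ_ν[(∂_νC)(y′−y)(∂_μC∂^*_ν)(y−y″)C(y′−y″) − (∂_νC∂^*_μ)(y′−y)(C∂^*_ν)(y−y″)C(y′−y″)]`.
[cite: Balaban1983Higgs3, (3.38) p.444] -/
theorem tri20_conv (ξ q3 : ℝ) (μ : Fin 3) (C : ZSite 3 → ℝ) (y' : ZSite 3) :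
    tri20 ξ q3 μ (fun a b => C (a - b)) (fun a b => C (a - b)) (fun a b => C (a - b)) y' = lhs338 ξ q3 C y' μ := by
  unfold tri20 lhs338
  congr 1
  refine tsum_congr fun y => tsum_congr fun w => ?_
  rw [show (2 * 3 : ℕ) = 6 from rfl]
  congr 1
  refine Finset.sum_congr rfl fun ν _ => ?_
  rw [dK1_conv, d2K_conv, d2K_conv, dK2_conv]

/-- **(3.38): the pure-`C^ξ` triangle factor of (2.20) vanishes** — `T[C^ξ,C^ξ,C^ξ](y′) = 0` for every `ξ > 0`, `q³`, `μ`, `y′`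
(r15's (3.38) chain `B3Eq338Middle.eq338_direct`: first member = middle member = last member, a sum of odd functions).
[cite: Balaban1983Higgs3, (3.38) p.444] -/
theorem tri20_conv_Cxi {ξ : ℝ} (hξ : 0 < ξ) (q3 : ℝ) (μ : Fin 3) (y' : ZSite 3) :
    tri20 ξ q3 μ (fun a b => Cxi 3 ξ (a - b)) (fun a b => Cxi 3 ξ (a - b)) (fun a b => Cxi 3 ξ (a - b)) y' = 0 := by
  rw [tri20_conv]
  exact lhs338_eq_zero_of_eq338 ξ q3 (B3Eq338Middle.eq338_direct hξ q3) y' μ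

end Conv

end

end Literature.MathematicalPhysics.QuantumFieldTheory.Balaban1983to89.B3Eq338KernelForm
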